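import Mathlib
import Literature.Geometry.Lorentzian.ReggeWheelerTortoise

/-!
# Route PhotonSphereChannels — power-law inverse-square asymptotics of the Regge–Wheeler
# potential on the null-infinity side (`FixedModeChannels`, stmt-FinalStateConjecture-10048)

Helper for the FAR half-line channel estimate. In the tortoise variable `y = x − xc` (photon sphere
at `y = 0`, so `y = r − 3M + 2M log((r − 2M)/M)`), the Regge–Wheeler potential
`V_{s,ℓ}(r(x)) = (1 − 2M/r)(ℓ(ℓ+1)/r² + (1 − s²)2M/r³)` is inverse-square up to a power-law tail:

  `|V_{s,ℓ}(r(xc + y)) − ℓ(ℓ+1)/y²| ≤ 200 (ℓ+1)² √M · y^{-5/2}`   for `y ≥ max(9M, 1)`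

(`rwPotential_far_inverseSquare`; the true error is `O(M ℓ² log y / y³)`, the power `5/2` is what
the Volterra / defect-correction chain of `Literature.Analysis.ODE.InverseSquareCorrectedChain`
consumes). Elementary: `y/3 ≤ r ≤ y + 3M` and `|r − y| ≤ 6√(My)` from `0 ≤ log z ≤ z − 1`,
`log z ≤ 2√z` (`z = (r−2M)/M ≥ 1`), then `|1/r² − 1/y²| ≤ 126 √M y^{-5/2}` and the two `O(M/r³)`
terms. No new definitions.
-/

namespace Summit.FinalStateConjecture.FinalStateConjecture.Theorems

open Real Set Literature.Geometry.Lorentzian.ReggeWheeler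

section FarPotential

variable {M : ℝ} {r : ℝ → ℝ} {xc : ℝ}

/-- `|a − b + c| ≤ |a| + |b| + |c|`. [folklore] -/
theorem abs_sub_add_le_three (a b c : ℝ) : |a - b + c| ≤ |a| + |b| + |c| := by
  have h1 := abs_add_le (a - b) c
  have h2 := abs_sub a b
  linarith

/-- The numerical coefficient of `rwPotential_far_inverseSquare`. [folklore] -/
theorem farPotential_coef_bound (ℓ : ℕ) :
    144 * ((ℓ : ℝ) * ((ℓ : ℝ) + 1)) + 54 ≤ 200 * ((ℓ : ℝ) + 1) ^ 2 := by
  nlinarith [(Nat.cast_nonneg ℓ : (0 : ℝ) ≤ ℓ)]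

/-- **Two-sided control of the area radius by the tortoise variable on the far side.** For a
tortoise radius function and `y ≥ max(9M, 1)`, with `R = r(xc + y)`:
`3M ≤ R`, `R ≤ y + 3M`, `y/3 ≤ R` and `|R − y| ≤ 6 √(M y)`. -/
theorem tortoise_far_bounds_sqrt (h : IsTortoiseRadius M r xc) {y : ℝ} (hy : max (9 * M) 1 ≤ y) :
    3 * M ≤ r (xc + y) ∧ r (xc + y) ≤ y + 3 * M ∧ y / 3 ≤ r (xc + y) ∧
      |r (xc + y) - y| ≤ 6 * Real.sqrt (M * y) := by
  have hM : 0 < M := h.mass_pos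
  have h9 : 9 * M ≤ y := (le_max_left _ _).trans hy
  have hy1 : 1 ≤ y := (le_max_right _ _).trans hy
  have hy0 : 0 < y := by linarith
  set R : ℝ := r (xc + y) with hR
  have hR2 : 2 * M < R := h.two_mul_lt _
  have hRM : 0 < R - 2 * M := by linarith
  -- the tortoise identity `y = R − 3M + 2M log((R − 2M)/M)`
  have hid : y = R - 3 * M + 2 * M * Real.log ((R - 2 * M) / M) := by
    have h1 := h.tortoiseCoord_eq (xc + y)
    rw [add_sub_cancel_left] at h1
    rw [← h1, tortoiseCoord, Real.log_div hRM.ne' hM.ne']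
    ring
  set z : ℝ := (R - 2 * M) / M with hz
  have hz0 : 0 < z := div_pos hRM hM
  -- (a) `R ≥ 3M`: otherwise `log z < 0` and `y < 0`
  have h3M : 3 * M ≤ R := by
    by_contra hlt
    push Not at hlt
    have hz1 : z < 1 := by rw [hz, div_lt_one hM]; linarith
    have hlog : Real.log z < 0 := Real.log_neg hz0 hz1
    have : y < 0 := by
      rw [hid]
      have : 2 * M * Real.log z < 0 := mul_neg_of_pos_of_neg (by positivity) hlog
      linarith
    linarith
  have hlog0 : 0 ≤ Real.log z := Real.log_nonneg (by rw [hz, le_div_iff₀ hM]; linarith)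
  have hup : R ≤ y + 3 * M := by
    rw [hid]
    have : 0 ≤ 2 * M * Real.log z := by positivity
    linarith
  -- (c) `R ≥ y/3` from `log z ≤ z − 1`
  have hlow : y / 3 ≤ R := by
    have h1 : Real.log z ≤ z - 1 := Real.log_le_sub_one_of_pos hz0
    have h2 : y ≤ R - 3 * M + 2 * M * (z - 1) := by
      rw [hid]; have := mul_le_mul_of_nonneg_left h1 (by positivity : (0 : ℝ) ≤ 2 * M); linarith
    have h3 : 2 * M * (z - 1) = 2 * (R - 2 * M) - 2 * M := by
      rw [hz]; field_simp
    rw [h3] at h2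
    linarith
  -- (b) `|R − y| ≤ 6√(My)` from `log z ≤ 2√z`
  have hsq : Real.sqrt (M * y) ^ 2 = M * y := Real.sq_sqrt (by positivity)
  have h3le : 3 * M ≤ Real.sqrt (M * y) := by
    rw [show 3 * M = Real.sqrt ((3 * M) ^ 2) by rw [Real.sqrt_sq (by positivity)]]
    exact Real.sqrt_le_sqrt (by nlinarith)
  have hdn : R - y ≤ 6 * Real.sqrt (M * y) := by linarith [Real.sqrt_nonneg (M * y)]
  have hup' : y - R ≤ 6 * Real.sqrt (M * y) := by
    have h1 : Real.log z ≤ 2 * Real.sqrt z := by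
      have h := Real.log_le_sub_one_of_pos (Real.sqrt_pos.2 hz0)
      rw [Real.log_sqrt hz0.le] at h
      linarith [Real.sqrt_nonneg z]
    have h2 : y ≤ R - 3 * M + 2 * M * (2 * Real.sqrt z) := by
      rw [hid]; have := mul_le_mul_of_nonneg_left h1 (by positivity : (0 : ℝ) ≤ 2 * M); linarith
    -- `M √z = √(M (R − 2M)) ≤ √(2 M y)`
    have h3 : M * Real.sqrt z ≤ Real.sqrt 2 * Real.sqrt (M * y) := by
      have e : M * Real.sqrt z = Real.sqrt (M * (R - 2 * M)) := by
        rw [hz, show M * (R - 2 * M) = M ^ 2 * ((R - 2 * M) / M) by field_simp,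
          Real.sqrt_mul (by positivity), Real.sqrt_sq hM.le]
      rw [e, ← Real.sqrt_mul (by norm_num)]
      exact Real.sqrt_le_sqrt (by nlinarith)
    have h4 : Real.sqrt 2 ≤ 3 / 2 := by
      rw [Real.sqrt_le_left (by norm_num)]; norm_num
    have h5 : M * Real.sqrt z ≤ 3 / 2 * Real.sqrt (M * y) :=
      h3.trans (mul_le_mul_of_nonneg_right h4 (Real.sqrt_nonneg _))
    nlinarith [Real.sqrt_nonneg (M * y)]
  exact ⟨h3M, hup, hlow, abs_le.2 ⟨by linarith, by linarith⟩⟩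

/-- **Power-law inverse-square tail of the Regge–Wheeler potential on the far side.** For every
tortoise radius function (`IsTortoiseRadius M r xc`), `s ≤ 2`, `ℓ : ℕ` and `y ≥ max(9M, 1)`:
`|V_{s,ℓ}(r(xc + y)) − ℓ(ℓ+1)/y²| ≤ 200(ℓ+1)²√M · y^{-5/2}`. -/
theorem rwPotential_far_inverseSquare (h : IsTortoiseRadius M r xc) {s : ℕ} (hs : s ≤ 2) (ℓ : ℕ)
    {y : ℝ} (hy : max (9 * M) 1 ≤ y) :
    |(1 - 2 * M / r (xc + y)) * ((ℓ : ℝ) * ((ℓ : ℝ) + 1) / r (xc + y) ^ 2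
        + (1 - (s : ℝ) ^ 2) * (2 * M) / r (xc + y) ^ 3) - (ℓ : ℝ) * ((ℓ : ℝ) + 1) / y ^ 2|
      ≤ 200 * ((ℓ : ℝ) + 1) ^ 2 * Real.sqrt M * y ^ (-(5 / 2 : ℝ)) := by
  have hM : 0 < M := h.mass_pos
  have h9 : 9 * M ≤ y := (le_max_left _ _).trans hy
  have hy1 : 1 ≤ y := (le_max_right _ _).trans hy
  have hy0 : 0 < y := by linarith
  obtain ⟨h3M, hup, hlow, habs⟩ := tortoise_far_bounds_sqrt h hy
  set R : ℝ := r (xc + y) with hR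
  have hR0 : 0 < R := by linarith
  set S : ℝ := Real.sqrt (M * y) with hS
  have hS0 : 0 ≤ S := Real.sqrt_nonneg _
  have hSsq : S ^ 2 = M * y := Real.sq_sqrt (by positivity)
  have hSM : Real.sqrt M * Real.sqrt y = S := by rw [hS, Real.sqrt_mul hM.le]
  -- `y^{-5/2} = 1/(y² √y)`
  have hpow : y ^ (-(5 / 2 : ℝ)) = 1 / (y ^ 2 * Real.sqrt y) := by
    rw [Real.rpow_neg hy0.le, one_div, show (5 / 2 : ℝ) = (2 : ℕ) + 1 / 2 by norm_num,
      Real.rpow_add hy0, Real.rpow_natCast, Real.sqrt_eq_rpow]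
  have hsy : 0 < Real.sqrt y := Real.sqrt_pos.2 hy0
  have hsy2 : Real.sqrt y ^ 2 = y := Real.sq_sqrt hy0.le
  -- `√M ≤ √y / 3` and `M ≤ √M √y / 3`
  have hsqM : Real.sqrt M * 3 ≤ Real.sqrt y := by
    rw [show Real.sqrt M * 3 = Real.sqrt (9 * M) by
      rw [show (9 : ℝ) * M = 3 ^ 2 * M by ring, Real.sqrt_mul (by norm_num), Real.sqrt_sq (by norm_num)]; ring]
    exact Real.sqrt_le_sqrt h9
  have hMle : M ≤ Real.sqrt M * Real.sqrt y / 3 := by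
    have hM0 := Real.sqrt_nonneg M
    calc M = Real.sqrt M * Real.sqrt M := (Real.mul_self_sqrt hM.le).symm
      _ ≤ Real.sqrt M * (Real.sqrt y / 3) := by gcongr; linarith
      _ = Real.sqrt M * Real.sqrt y / 3 := by ring
  rw [hpow]
  -- split the difference into three terms
  have hsplit : (1 - 2 * M / R) * ((ℓ : ℝ) * ((ℓ : ℝ) + 1) / R ^ 2 + (1 - (s : ℝ) ^ 2) * (2 * M) / R ^ 3)
        - (ℓ : ℝ) * ((ℓ : ℝ) + 1) / y ^ 2
      = (ℓ : ℝ) * ((ℓ : ℝ) + 1) * (1 / R ^ 2 - 1 / y ^ 2) - 2 * M * ((ℓ : ℝ) * ((ℓ : ℝ) + 1)) / R ^ 3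
        + (1 - 2 * M / R) * (1 - (s : ℝ) ^ 2) * (2 * M) / R ^ 3 := by
    ring
  rw [hsplit]
  have hℓ : (0 : ℝ) ≤ (ℓ : ℝ) * ((ℓ : ℝ) + 1) := by positivity
  have hℓ1 : (ℓ : ℝ) * ((ℓ : ℝ) + 1) ≤ ((ℓ : ℝ) + 1) ^ 2 := by nlinarith [(Nat.cast_nonneg ℓ : (0:ℝ) ≤ ℓ)]
  -- term 1: `|1/R² − 1/y²| ≤ 126 √M / (y²√y)`
  have hR3 : y ^ 2 / 9 ≤ R ^ 2 := by nlinarith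
  have t1 : |1 / R ^ 2 - 1 / y ^ 2| ≤ 126 * Real.sqrt M / (y ^ 2 * Real.sqrt y) := by
    have e : 1 / R ^ 2 - 1 / y ^ 2 = (y - R) * (y + R) / (R ^ 2 * y ^ 2) := by
      field_simp; ring
    rw [e, abs_div, abs_mul, abs_of_pos (by positivity : (0 : ℝ) < R ^ 2 * y ^ 2),
      abs_of_pos (by positivity : (0 : ℝ) < y + R), div_le_div_iff₀ (by positivity) (by positivity)]
    have h1 : |y - R| ≤ 6 * S := by rw [abs_sub_comm]; exact habs
    have h2 : y + R ≤ 7 * y / 3 := by linarith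
    calc |y - R| * (y + R) * (y ^ 2 * Real.sqrt y) ≤ (6 * S) * (7 * y / 3) * (y ^ 2 * Real.sqrt y) := by
          gcongr
      _ = 14 * (Real.sqrt M) * (Real.sqrt y * Real.sqrt y) * y * y ^ 2 := by rw [← hSM]; ring
      _ = 14 * Real.sqrt M * y ^ 2 * y ^ 2 := by rw [← sq, hsy2]; ring
      _ = 126 * Real.sqrt M * ((y ^ 2 / 9) * y ^ 2) := by ring
      _ ≤ 126 * Real.sqrt M * (R ^ 2 * y ^ 2) := by gcongr
  -- term 2 and 3: `M/R³ ≤ 27 M / y³ ≤ 9 √M / (y²√y)`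
  have hR3' : y ^ 3 / 27 ≤ R ^ 3 := by nlinarith
  have t23 : M / R ^ 3 ≤ 9 * Real.sqrt M / (y ^ 2 * Real.sqrt y) := by
    rw [div_le_div_iff₀ (by positivity) (by positivity)]
    calc M * (y ^ 2 * Real.sqrt y) ≤ (Real.sqrt M * Real.sqrt y / 3) * (y ^ 2 * Real.sqrt y) := by gcongr
      _ = Real.sqrt M * y ^ 2 * (Real.sqrt y ^ 2) / 3 := by ring
      _ = Real.sqrt M * (y ^ 3 / 27) * 9 := by rw [hsy2]; ring
      _ ≤ Real.sqrt M * R ^ 3 * 9 := by gcongr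
      _ = 9 * Real.sqrt M * R ^ 3 := by ring
  have t2 : |2 * M * ((ℓ : ℝ) * ((ℓ : ℝ) + 1)) / R ^ 3|
      ≤ 18 * ((ℓ : ℝ) * ((ℓ : ℝ) + 1)) * Real.sqrt M / (y ^ 2 * Real.sqrt y) := by
    rw [abs_of_nonneg (by positivity)]
    calc 2 * M * ((ℓ : ℝ) * ((ℓ : ℝ) + 1)) / R ^ 3 = 2 * ((ℓ : ℝ) * ((ℓ : ℝ) + 1)) * (M / R ^ 3) := by ring
      _ ≤ 2 * ((ℓ : ℝ) * ((ℓ : ℝ) + 1)) * (9 * Real.sqrt M / (y ^ 2 * Real.sqrt y)) := by gcongr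
      _ = _ := by ring
  have hred : |1 - 2 * M / R| ≤ 1 := by
    have h1 : 0 ≤ 2 * M / R := by positivity
    have h2 : 2 * M / R ≤ 1 := by rw [div_le_one hR0]; linarith
    rw [abs_of_nonneg (by linarith)]; linarith
  have hs3 : |1 - (s : ℝ) ^ 2| ≤ 3 := by
    interval_cases s <;> norm_num
  have t3 : |(1 - 2 * M / R) * (1 - (s : ℝ) ^ 2) * (2 * M) / R ^ 3| ≤ 54 * Real.sqrt M / (y ^ 2 * Real.sqrt y) := by
    rw [show (1 - 2 * M / R) * (1 - (s : ℝ) ^ 2) * (2 * M) / R ^ 3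
        = ((1 - 2 * M / R) * (1 - (s : ℝ) ^ 2)) * (2 * (M / R ^ 3)) by ring, abs_mul, abs_mul,
      abs_of_nonneg (by positivity : (0 : ℝ) ≤ 2 * (M / R ^ 3))]
    calc |1 - 2 * M / R| * |1 - (s : ℝ) ^ 2| * (2 * (M / R ^ 3))
        ≤ 1 * 3 * (2 * (9 * Real.sqrt M / (y ^ 2 * Real.sqrt y))) := by gcongr
      _ = 54 * Real.sqrt M / (y ^ 2 * Real.sqrt y) := by ring
  -- combine (name the three terms and the scale to keep the terms small)
  set D : ℝ := Real.sqrt M / (y ^ 2 * Real.sqrt y) with hD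
  have hD0 : 0 ≤ D := by positivity
  set a : ℝ := (ℓ : ℝ) * ((ℓ : ℝ) + 1) * (1 / R ^ 2 - 1 / y ^ 2) with ha
  set b : ℝ := 2 * M * ((ℓ : ℝ) * ((ℓ : ℝ) + 1)) / R ^ 3 with hb
  set c : ℝ := (1 - 2 * M / R) * (1 - (s : ℝ) ^ 2) * (2 * M) / R ^ 3 with hc
  have Ta : |a| ≤ (ℓ : ℝ) * ((ℓ : ℝ) + 1) * (126 * D) := by
    rw [ha, abs_mul, abs_of_nonneg hℓ]
    refine mul_le_mul_of_nonneg_left ?_ hℓ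
    simpa [hD, mul_div_assoc] using t1
  have Tb : |b| ≤ 18 * ((ℓ : ℝ) * ((ℓ : ℝ) + 1)) * D := by
    simpa [hb, hD, mul_div_assoc] using t2
  have Tc : |c| ≤ 54 * D := by simpa [hc, hD, mul_div_assoc] using t3
  calc |a - b + c| ≤ |a| + |b| + |c| := abs_sub_add_le_three a b c
    _ ≤ (ℓ : ℝ) * ((ℓ : ℝ) + 1) * (126 * D) + 18 * ((ℓ : ℝ) * ((ℓ : ℝ) + 1)) * D + 54 * D :=
        add_le_add_three Ta Tb Tc
    _ = (144 * ((ℓ : ℝ) * ((ℓ : ℝ) + 1)) + 54) * D := by ring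
    _ ≤ (200 * ((ℓ : ℝ) + 1) ^ 2) * D := mul_le_mul_of_nonneg_right (farPotential_coef_bound ℓ) hD0
    _ = 200 * ((ℓ : ℝ) + 1) ^ 2 * Real.sqrt M * (1 / (y ^ 2 * Real.sqrt y)) := by
        rw [hD]; ring

end FarPotential

end Summit.FinalStateConjecture.FinalStateConjecture.Theorems
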